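import Summits.QuantumFields.BalabanUV.Beta.FP.GhostLoopCountingMixRate
import Summits.QuantumFields.BalabanUV.Beta.FP.GhostLoopCountingMixQuartic
import Summits.QuantumFields.BalabanUV.Beta.FP.MixLoopInstanceBlockFamilyGamma

/-!
# `Beta/FP/GhostPiecesAtColumns` — road «FP» (binder row D1), ROW KER-γ (α2) sub-row **α2-c PART 1** (owner ruling R-FP-35 (a), statement memo
# `HOME/b2b-balaban-beta-d1-formalise-leaf-05/g15/ALPHA2C-STATEMENT.md` §3∕§5): THE FOUR SCALAR (GHOST) MIX ENDs AT THE ROAD's COLUMNS — the (g4) engines of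
# `GhostLoopCountingMix{,Quartic,Cubic,Gamma}` (0-form rooted block family, abstract legs) instantiated with the OUTER columns `J_m := N⁴•colOf (KPerf Lc (sfStep Lc) (smStep 3 Lc) m)`
# (the VECTOR background minimiser of the one shot, `N = Lc^m` — the ghost action sees the coarse field only through `U_nV`, exactly as the gluon MIX instances
# `MixLoopInstanceBlockFamily*`) and the INNER leg `I := kerH (N−1) a` (the SCALAR minimiser of (I-gh)), at the common rate `δ = min(κ₀∕4, deltaH 4 1)`

HONEST FRAMING (cell `pub-balaban`, β sub-cell, verbatim): discharging `BetaPertH` makes Bałaban's UV stability UNCONDITIONAL — a real constructive-QFT result; it is NOT the continuum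
limit and NOT the Clay problem.  THIS MODULE is [folklore]∕[our object] plumbing: the ABSTRACT engines `coarse_mix2_secondMoment_scl_free`, `coarse_mix4_secondMoment_scl`,
`coarse_mix3_secondMoment_scl`, `coarse_mix1_secondMoment_scl` BY NAME, fed with the column letters `MixLoopInstanceBlockFamilyGamma.latticeColumn_letterJ_of_le` (perfect columns,
rate weakened) and `GhostLoopCountingMixRate.ghostColumn_engineLetters_of_le` (scalar minimiser, rate weakened); no `def`, no `def … : Prop`, nothing cited, 0 sorry.  PRECISION
E-d1leaf05g15-1 (journal 2026-08-21T06:13:49Z): the gen-14 ENDs `ghost_mix{1,2,3,4}_rem` fix the OUTER columns `J := kerH` — instances for a scalar block-spin model; the road's ghost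
pieces in the socket's `dressedEntryP (c a ↦ colH (KPerf…) …)` currency have VECTOR outer columns; this file supplies them.  NOT the identification of the words with the literal's ghost
table (α2-c PART 2, hypothesis `Fgh` displayed), NOT the `Γ`∕`𝔊`∕`Ḣ` instances (RHOA-4-GH loc ∕ `CoarseInverseScalar` ∕ LEDGER), NOT the instance number, NOT `Mix_n = O(1)`, NOT hbook, NOT D1,
NOT BetaPertH, NOT continuum, NOT Clay.
HONEST DEPENDENCY: continuum YM on T⁴ ⇐ BetaPertH ∧ nine spine estimates (0/9 proved); BetaPertH ⇐ (D1) ∧ (D4) ∧ CAP+tail; G-an2-4 gates asym, D1 and NE2/3/4.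

ABSOLUTE RULE (cell charter, verbatim): «No internally-minted statement may enter as a cited fact. Every hypothesis is either kernel-proved in this package or a verbatim quotation of a
PUBLISHED theorem with page reference. The manuscript(s) under audit are NOT citable for their own disputed steps — they are the thing under adjudication; programme-internal
(2001/route/tribunal) claims are never citable.»

CONTENT (`d = 4` lattice, `2 ≤ Lc`; `∃ δ₀ C D Cg` stands BEFORE `∀ δ m a` and before the family data; every END holds for ALL rates `δ ∈ (0, δ₀]`, so the consumer may lower `δ` to a
leg's own rate).  §1 `roadColumns_ghostLetters` — ONE `δ₀ > 0` and constants `C, D, Cg ≥ 0` such that for ALL `δ ∈ (0, δ₀]`, `m ≥ 1`, `κ l`, `a > 0`, `N = Lc^m`: (J) `|J_m κ l (N•u − c)| ≤ C·N⁻¹·e^{−(δ∕N)‖c − N•u‖∞}`, (J′) `Σ_{v∈V}(1 + (‖b−N•v‖∕N)²)|J_m κ l (N•v − b)| ≤ D·N⁻¹`, (I) `|kerH (N−1) a c u| ≤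
Cg·e^{−(δ∕N)‖c − N•u‖∞}` and (I₀) `≤ Cg`.  §2 the four ENDs **`ghost_mix2_rem_col`**, **`ghost_mix4_rem_col`**, **`ghost_mix3_rem_col`**, **`ghost_mix1_rem_col`** — every power of `N`
displayed: relative to the scalar-model ENDs the two outer columns contribute `C·N⁻¹` and `D·N⁻¹` (the gluon pieces carry the same two factors).
Provenance: D1 formalisation swarm, unit `b2b-balaban-beta-d1-formalise-leaf-05` gen 15, 2026-08-21; «not in print; our bookkeeping»; no existing file touched.
-/

noncomputable section

namespace Summit.QuantumFields.BalabanUV.Beta.FP.GhostPiecesAtColumns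

open Finset Real
open scoped BigOperators
open Literature.MathematicalPhysics.QuantumFieldTheory.Balaban1983to89
open Literature.MathematicalPhysics.QuantumFieldTheory.Balaban1983to89.Beta
open B12Sec2to5 (l1)
open ExpKernelCalculus (Zl)
open DyadicShell (Pt supNorm)
open AxialBlockWeights (fineBlock)
open B5Hk103ScalarZd (kerH deltaH deltaH_pos)
open Summit.QuantumFields.BalabanUV.Beta.GAN24.CombesThomas (sfStep smStep)
open Summit.QuantumFields.BalabanUV.Beta.FP.TransportInfinityM (colOf)
open Summit.QuantumFields.BalabanUV.Beta.FP.PerfectObjectsT (KPerf)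
open Summit.QuantumFields.BalabanUV.Beta.FP.AveragingJetLettersRooted (ker₁)
open Summit.QuantumFields.BalabanUV.Beta.FP.AveragingJetLettersRootedSecond (ker₂)
open Summit.QuantumFields.BalabanUV.Beta.FP.ScalarAveragingJetLetters (sclW sclFld sclBg)
open Summit.QuantumFields.BalabanUV.Beta.FP.MixLoopPowerCounting (supNorm_cast_nonneg)
open Summit.QuantumFields.BalabanUV.Beta.FP.GhostLoopCountingMix (coarse_mix2_secondMoment_scl_free)
open Summit.QuantumFields.BalabanUV.Beta.FP.GhostLoopCountingMixQuartic (coarse_mix4_secondMoment_scl)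
open Summit.QuantumFields.BalabanUV.Beta.FP.GhostLoopCountingMixCubic (coarse_mix3_secondMoment_scl)
open Summit.QuantumFields.BalabanUV.Beta.FP.GhostLoopCountingMixGamma (coarse_mix1_secondMoment_scl)
open Summit.QuantumFields.BalabanUV.Beta.FP.GhostLoopCountingMixRate (ghostColumn_engineLetters_of_le)
open Summit.QuantumFields.BalabanUV.Beta.FP.MixLoopInstanceBlockFamilyGamma (latticeColumn_letterJ_of_le)

variable {Lc : ℕ} [NeZero Lc]

/-! ## §1 The road's column letters at one common rate -/

/-- **THE ROAD's COLUMN LETTERS FOR THE GHOST PIECES, AT ANY COMMON RATE `δ ≤ δ₀`** ([folklore] packaging): ONE `δ₀ > 0` (= `min(κ₀∕4, deltaH 4 1)`) and `C, D, Cg ≥ 0` such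
that for ALL `δ ∈ (0, δ₀]` (so the consumer may lower the rate to a leg's own rate), `m ≥ 1`, `κ l : Fin 4`, `a > 0`, with `N = Lc^m` and `J_m := N⁴•colOf (KPerf Lc (sfStep Lc) (smStep 3 Lc) m)`: (J) `|J_m κ l (N•u − c)| ≤ C·N⁻¹·e^{−(δ∕N)‖c−N•u‖∞}`; (J′)
`Σ_{v∈V}(1 + (‖b − N•v‖∞∕N)²)·|J_m κ l (N•v − b)| ≤ D·N⁻¹`; (I) `|kerH (N−1) a c u| ≤ Cg·e^{−(δ∕N)‖c−N•u‖∞}` (hence (I₀) `≤ Cg`). -/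
theorem roadColumns_ghostLetters (hLc : 2 ≤ Lc) :
    ∃ δ₀ C D Cg : ℝ, 0 < δ₀ ∧ 0 ≤ C ∧ 0 ≤ D ∧ 0 ≤ Cg ∧ ∀ δ : ℝ, 0 < δ → δ ≤ δ₀ → ∀ m : ℕ, 1 ≤ m → ∀ (κ l : Fin 4) {a : ℝ}, 0 < a →
      (∀ c u : Pt,
        |((((Lc ^ m : ℕ) : ℝ) ^ 4) • colOf (KPerf (d := 3) Lc (sfStep Lc) (smStep 3 Lc) m)) κ l (((Lc ^ m : ℕ) : ℤ) • u - c)|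
          ≤ C * (((Lc ^ m : ℕ) : ℝ))⁻¹ * Real.exp (-(δ / ((Lc ^ m : ℕ) : ℝ)) * (supNorm (c - ((Lc ^ m : ℕ) : ℤ) • u) : ℝ))) ∧
      (∀ (b : Pt) (V : Finset Pt),
        ∑ v ∈ V, (1 + ((supNorm (b - ((Lc ^ m : ℕ) : ℤ) • v) : ℝ) / ((Lc ^ m : ℕ) : ℝ)) ^ 2)
            * |((((Lc ^ m : ℕ) : ℝ) ^ 4) • colOf (KPerf (d := 3) Lc (sfStep Lc) (smStep 3 Lc) m)) κ l (((Lc ^ m : ℕ) : ℤ) • v - b)|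
          ≤ D * (((Lc ^ m : ℕ) : ℝ))⁻¹) ∧
      (∀ c u : Pt, |kerH (Lc ^ m - 1) a c u| ≤ Cg * Real.exp (-(δ / ((Lc ^ m : ℕ) : ℝ)) * (supNorm (c - ((Lc ^ m : ℕ) : ℤ) • u) : ℝ))) ∧
      (∀ c u : Pt, |kerH (Lc ^ m - 1) a c u| ≤ Cg) := by
  obtain ⟨κ₀, C, hκ₀, hC, hJ⟩ := latticeColumn_letterJ_of_le (Lc := Lc) hLc
  obtain ⟨Cg, Cg', hCg, _, hg⟩ := ghostColumn_engineLetters_of_le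
  set δ₀ : ℝ := min (κ₀ / 4) (deltaH 4 1) with hδ₀_def
  have hδκ : δ₀ ≤ κ₀ / 4 := min_le_left _ _
  have hδH : δ₀ ≤ deltaH 4 1 := min_le_right _ _
  have hδ00 : 0 < δ₀ := lt_min (by positivity) (deltaH_pos 4 one_pos)
  set D : ℝ := C * ((1 + 16 / (κ₀ / 4) ^ 2) * (Real.exp (κ₀ / 4 / 2) * (1 + 480 * Real.exp (κ₀ / 4 / 2 / 2) * (2 / (κ₀ / 4 / 2)) ^ 4))) with hD_def
  refine ⟨δ₀, C, D, Cg, hδ00, hC, by positivity, hCg, fun δ hδ0 hδle m hm κ l a ha => ?_⟩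
  have hN1 : 1 ≤ Lc ^ m := Nat.one_le_pow m Lc (le_trans (by norm_num) hLc)
  obtain ⟨hJ1, hJ2⟩ := hJ δ (hδle.trans hδκ) m hm κ l
  obtain ⟨hI, _⟩ := hg δ hδ0 (hδle.trans hδH) ha (Lc ^ m) hN1
  refine ⟨hJ1, fun b V => ?_, fun c u => ?_, fun c u => ?_⟩
  · refine (hJ2 b V).trans (le_of_eq ?_)
    rw [hD_def]; ring
  · have := hI c u
    simpa using this
  · have h1 := hI c u
    have h2 : Real.exp (-(δ / ((Lc ^ m : ℕ) : ℕ)) * (supNorm (c - ((Lc ^ m : ℕ) : ℤ) • u) : ℝ)) ≤ 1 := by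
      apply Real.exp_le_one_iff.mpr
      have hx : (0 : ℝ) ≤ (supNorm (c - ((Lc ^ m : ℕ) : ℤ) • u) : ℝ) := Nat.cast_nonneg _
      have : (0 : ℝ) ≤ δ / ((Lc ^ m : ℕ) : ℕ) := by positivity
      nlinarith
    calc |kerH (Lc ^ m - 1) a c u| ≤ Cg * Real.exp (-(δ / ((Lc ^ m : ℕ) : ℕ)) * (supNorm (c - ((Lc ^ m : ℕ) : ℤ) • u) : ℝ)) := by
          simpa using h1
      _ ≤ Cg * 1 := mul_le_mul_of_nonneg_left h2 hCg
      _ = Cg := mul_one Cg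

/-! ## §2 The four ghost MIX ENDs at the road's columns -/

section Ends

/-- **`ghost_mix2_rem_col` — THE (MIX-2) SCALAR WORD AT THE ROAD's COLUMNS** ([our object]): with `(δ₀, C, D, Cg)` of `roadColumns_ghostLetters`, for EVERY rate `δ ∈ (0, δ₀]`, `m ≥ 1`, `a > 0`, leg pair
`(κJ,lJ)`, every 0-form rooted block family at blocking `N = Lc^m` (rules `σ`, `p σ ≥ 0`, radial words of length `≤ ℓ₀` within `R₀·N` of the anchor), all finite windows `Y`, `W`, `S`, `V` and
every `v₀`, OUTER columns `J_m κJ lJ (N•v − b)`, INNER leg `kerH (N−1) a`: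
`Σ_{v∈V}‖v−v₀‖∞²·|Σ_{b,b′∈S} J_m(N•v₀−b)·J_m(N•v−b′)·Σ_{u,u′∈Y}(Σ_w ker₁^{(u)} b (b+w)·kerH(b+w,u′))·(Σ_{w′} ker₁^{(u′)} b′ (b′+w′)·kerH(b′+w′,u))|`
`≤ 3·(Cg·e^{2(R₀+1)δ})²·(C·N⁻¹)·(D·N⁻¹)·(1+20∕δ²)·((ℓ₀·Σp)·e^{δR₀∕2}·(e^{δ∕2}(1+480e^{δ∕4}(4∕δ)⁴)))²` — powers of `N` displayed: `N⁻²·(ℓ₀Σp)²` × numbers. -/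
theorem ghost_mix2_rem_col (hLc : 2 ≤ Lc) :
    ∃ δ₀ C D Cg : ℝ, 0 < δ₀ ∧ 0 ≤ C ∧ 0 ≤ D ∧ 0 ≤ Cg ∧ ∀ δ : ℝ, 0 < δ → δ ≤ δ₀ → ∀ m : ℕ, 1 ≤ m → ∀ {a : ℝ}, 0 < a → ∀ (κJ lJ : Fin 4)
      {σ : Type*} [Fintype σ] {p : σ → ℝ} (_ : ∀ s, 0 ≤ p s)
        {rad : σ → Pt → Pt → List Pt} {ℓ₀ R₀ : ℕ} (_ : ∀ s u x', (rad s u x').length ≤ ℓ₀)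
        (_ : ∀ (s : σ) (u : Pt) (x : ↥(fineBlock (Lc ^ m))) (ℓ : Pt), ℓ ∈ rad s u x.1 → supNorm (ℓ - ((Lc ^ m : ℕ) : ℤ) • u) ≤ R₀ * Lc ^ m)
        (Y W S V : Finset Pt) (v₀ : Pt),
        ∑ v ∈ V, (supNorm (v - v₀) : ℝ) ^ 2 *
            |∑ b ∈ S, ∑ b' ∈ S, ((((Lc ^ m : ℕ) : ℝ) ^ 4) • colOf (KPerf (d := 3) Lc (sfStep Lc) (smStep 3 Lc) m)) κJ lJ (((Lc ^ m : ℕ) : ℤ) • v₀ - b) * ((((Lc ^ m : ℕ) : ℝ) ^ 4) • colOf (KPerf (d := 3) Lc (sfStep Lc) (smStep 3 Lc) m)) κJ lJ (((Lc ^ m : ℕ) : ℤ) • v - b') *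
              (∑ u ∈ Y, ∑ u' ∈ Y,
                (∑ w ∈ W, ker₁ (sclW (Lc ^ m) p) (sclFld (Lc ^ m) u) (sclBg (Lc ^ m) u rad) b (b + w) * kerH (Lc ^ m - 1) a (b + w) u') *
                (∑ w' ∈ W, ker₁ (sclW (Lc ^ m) p) (sclFld (Lc ^ m) u') (sclBg (Lc ^ m) u' rad) b' (b' + w') * kerH (Lc ^ m - 1) a (b' + w') u))|
          ≤ 3 * (Cg * Real.exp (2 * ((R₀ : ℝ) + 1) * δ)) ^ 2 * (C * (((Lc ^ m : ℕ) : ℝ))⁻¹) * (D * (((Lc ^ m : ℕ) : ℝ))⁻¹) * (1 + 20 / δ ^ 2) *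
              ((((ℓ₀ : ℕ) : ℝ) * ∑ s, p s) * Real.exp (δ * R₀ / 2) *
                (Real.exp (δ / 2) * (1 + 480 * Real.exp (δ / 4) * (4 / δ) ^ 4))) ^ 2 := by
  obtain ⟨δ₀, C, D, Cg, hδ₀, hC, hD, hCg, h⟩ := roadColumns_ghostLetters (Lc := Lc) hLc
  refine ⟨δ₀, C, D, Cg, hδ₀, hC, hD, hCg, fun δ hδ hδle m hm a ha κJ lJ σ _ p hp rad ℓ₀ R₀ hrad hradR Y W S V v₀ => ?_⟩
  have hN1 : 1 ≤ Lc ^ m := Nat.one_le_pow m Lc (le_trans (by norm_num) hLc)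
  obtain ⟨hJ, hJ', hI, _⟩ := h δ hδ hδle m hm κJ lJ ha
  exact coarse_mix2_secondMoment_scl_free (N := Lc ^ m) hδ hN1 hp hrad hradR Y W
    (I := fun c u => kerH (Lc ^ m - 1) a c u) (J := fun b v => ((((Lc ^ m : ℕ) : ℝ) ^ 4) • colOf (KPerf (d := 3) Lc (sfStep Lc) (smStep 3 Lc) m)) κJ lJ (((Lc ^ m : ℕ) : ℤ) • v - b))
    (fun c u => hI c u) S V v₀ (fun b => hJ b v₀) (fun b' => hJ' b' V)

/-- **`ghost_mix4_rem_col` — THE (MIX-4) SCALAR WORD AT THE ROAD's COLUMNS** ([our object]): with `(δ₀, C, D, Cg)` of `roadColumns_ghostLetters`, for EVERY rate `δ ∈ (0, δ₀]`, `m ≥ 1`, `a > 0`, every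
0-form rooted block family at blocking `N = Lc^m`, ANY coarse windows `U b`, all finite `W`, `S`, `V`, every `v₀`:
`Σ_{v∈V}‖v−v₀‖∞²·|Σ_{b,b′∈S} J_m(N•v₀−b)·J_m(N•v−b′)·Σ_{u∈U b}Σ_{w∈W} ker₂^{(u)} b b′ (b+w)·kerH(b+w,u)|`
`≤ 3·(C·N⁻¹)·(D·N⁻¹)·(1+16∕δ²)·(Cg·((1+4R₀²)·(2ℓ₀·(ℓ₀·Σp))·e^{δR₀∕2}·(e^{δ∕2}(1+480e^{δ∕4}(4∕δ)⁴))))` — powers of `N` displayed: `N⁻²·ℓ₀²Σp` × numbers. -/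
theorem ghost_mix4_rem_col (hLc : 2 ≤ Lc) :
    ∃ δ₀ C D Cg : ℝ, 0 < δ₀ ∧ 0 ≤ C ∧ 0 ≤ D ∧ 0 ≤ Cg ∧ ∀ δ : ℝ, 0 < δ → δ ≤ δ₀ → ∀ m : ℕ, 1 ≤ m → ∀ {a : ℝ}, 0 < a → ∀ (κJ lJ : Fin 4)
      {σ : Type*} [Fintype σ] {p : σ → ℝ} (_ : ∀ s, 0 ≤ p s)
        {rad : σ → Pt → Pt → List Pt} {ℓ₀ R₀ : ℕ} (_ : ∀ s u x', (rad s u x').length ≤ ℓ₀)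
        (_ : ∀ (s : σ) (u : Pt) (x : ↥(fineBlock (Lc ^ m))) (ℓ : Pt), ℓ ∈ rad s u x.1 → supNorm (ℓ - ((Lc ^ m : ℕ) : ℤ) • u) ≤ R₀ * Lc ^ m)
        (U : Pt → Finset Pt) (W S V : Finset Pt) (v₀ : Pt),
        ∑ v ∈ V, (supNorm (v - v₀) : ℝ) ^ 2 *
            |∑ b ∈ S, ∑ b' ∈ S, ((((Lc ^ m : ℕ) : ℝ) ^ 4) • colOf (KPerf (d := 3) Lc (sfStep Lc) (smStep 3 Lc) m)) κJ lJ (((Lc ^ m : ℕ) : ℤ) • v₀ - b) * ((((Lc ^ m : ℕ) : ℝ) ^ 4) • colOf (KPerf (d := 3) Lc (sfStep Lc) (smStep 3 Lc) m)) κJ lJ (((Lc ^ m : ℕ) : ℤ) • v - b') *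
              (∑ u ∈ U b, ∑ w ∈ W, ker₂ (sclW (Lc ^ m) p) (sclFld (Lc ^ m) u) (sclBg (Lc ^ m) u rad) b b' (b + w) * kerH (Lc ^ m - 1) a (b + w) u)|
          ≤ 3 * (C * (((Lc ^ m : ℕ) : ℝ))⁻¹) * (D * (((Lc ^ m : ℕ) : ℝ))⁻¹) * (1 + 16 / δ ^ 2) * (Cg * ((1 + 4 * (R₀ : ℝ) ^ 2) *
              (((2 * ((ℓ₀ : ℕ) : ℝ)) * (((ℓ₀ : ℕ) : ℝ) * ∑ s, p s)) * Real.exp (δ * R₀ / 2) *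
                (Real.exp (δ / 2) * (1 + 480 * Real.exp (δ / 4) * (4 / δ) ^ 4))))) := by
  obtain ⟨δ₀, C, D, Cg, hδ₀, hC, hD, hCg, h⟩ := roadColumns_ghostLetters (Lc := Lc) hLc
  refine ⟨δ₀, C, D, Cg, hδ₀, hC, hD, hCg, fun δ hδ hδle m hm a ha κJ lJ σ _ p hp rad ℓ₀ R₀ hrad hradR U W S V v₀ => ?_⟩
  have hN1 : 1 ≤ Lc ^ m := Nat.one_le_pow m Lc (le_trans (by norm_num) hLc)
  obtain ⟨hJ, hJ', _, hI0⟩ := h δ hδ hδle m hm κJ lJ ha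
  exact coarse_mix4_secondMoment_scl (N := Lc ^ m) hδ hN1 hp hrad hradR U W
    (I := fun c u => kerH (Lc ^ m - 1) a c u) (J := fun b v => ((((Lc ^ m : ℕ) : ℝ) ^ 4) • colOf (KPerf (d := 3) Lc (sfStep Lc) (smStep 3 Lc) m)) κJ lJ (((Lc ^ m : ℕ) : ℤ) • v - b))
    (fun c u => hI0 c u) S V v₀ (fun b => hJ b v₀) (fun b' => hJ' b' V)

/-- **`ghost_mix1_rem_col` — THE (MIX-1) SCALAR WORD AT THE ROAD's COLUMNS** ([our object]): with `(δ₀, C, D, Cg)` of `roadColumns_ghostLetters` (only the columns' letters enter), for EVERY rate `δ ∈ (0, δ₀]`,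
`m ≥ 1`, every 0-form rooted block family at blocking `N = Lc^m`, ANY coarse windows `U b`, all finite `W`, every coarse scalar covariance `G` with (G₀) `|G u u′| ≤ C_G` and fine profile `Γ` with
(Γ) `|Γ c c′| ≤ C_Γ(‖c−c′‖∞+1)⁻²e^{−(δ∕N)‖c−c′‖∞}`, all finite `S`, `V`, every `v₀`:
`Σ_{v∈V}‖v−v₀‖∞²·|Σ_{b,b′∈S} J_m(N•v₀−b)·J_m(N•v−b′)·Σ_{u∈U b,u′∈U b′} G u′ u·Σ_{w,w′∈W} ker₁^{(u)} b (b+w)·Γ(b+w,b′+w′)·ker₁^{(u′)} b′ (b′+w′)|`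
`≤ 3·(C·N⁻¹)·(D·N⁻¹)·(1+16∕δ²)·(C_G·(C_Γ·(3+8(R₀+1)²))·((ℓ₀·(N⁻⁴·Σp))·((…)+(…))·N²)·((ℓ₀·Σp)·e^{δR₀∕2}·(…)))` — powers of `N` displayed: `N⁻⁴·(ℓ₀Σp)²·C_GC_Γ` × numbers. -/
theorem ghost_mix1_rem_col (hLc : 2 ≤ Lc) :
    ∃ δ₀ C D Cg : ℝ, 0 < δ₀ ∧ 0 ≤ C ∧ 0 ≤ D ∧ 0 ≤ Cg ∧ ∀ δ : ℝ, 0 < δ → δ ≤ δ₀ → ∀ m : ℕ, 1 ≤ m → ∀ (κJ lJ : Fin 4)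
      {σ : Type*} [Fintype σ] {p : σ → ℝ} (_ : ∀ s, 0 ≤ p s)
        {rad : σ → Pt → Pt → List Pt} {ℓ₀ R₀ : ℕ} (_ : ∀ s u x', (rad s u x').length ≤ ℓ₀)
        (_ : ∀ (s : σ) (u : Pt) (x : ↥(fineBlock (Lc ^ m))) (ℓ : Pt), ℓ ∈ rad s u x.1 → supNorm (ℓ - ((Lc ^ m : ℕ) : ℤ) • u) ≤ R₀ * Lc ^ m)
        (U : Pt → Finset Pt) (W : Finset Pt) {G Γ : Pt → Pt → ℝ} {C_G C_Γ : ℝ} (_ : ∀ u u', |G u u'| ≤ C_G)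
        (_ : ∀ c c', |Γ c c'| ≤ C_Γ / ((supNorm (c - c') : ℝ) + 1) ^ 2 * Real.exp (-(δ / ((Lc ^ m : ℕ) : ℝ)) * (supNorm (c - c') : ℝ)))
        (S V : Finset Pt) (v₀ : Pt),
        ∑ v ∈ V, (supNorm (v - v₀) : ℝ) ^ 2 *
            |∑ b ∈ S, ∑ b' ∈ S, ((((Lc ^ m : ℕ) : ℝ) ^ 4) • colOf (KPerf (d := 3) Lc (sfStep Lc) (smStep 3 Lc) m)) κJ lJ (((Lc ^ m : ℕ) : ℤ) • v₀ - b) * ((((Lc ^ m : ℕ) : ℝ) ^ 4) • colOf (KPerf (d := 3) Lc (sfStep Lc) (smStep 3 Lc) m)) κJ lJ (((Lc ^ m : ℕ) : ℤ) • v - b') *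
              (∑ u ∈ U b, ∑ u' ∈ U b', G u' u *
                ∑ w ∈ W, ∑ w' ∈ W, ker₁ (sclW (Lc ^ m) p) (sclFld (Lc ^ m) u) (sclBg (Lc ^ m) u rad) b (b + w) * Γ (b + w) (b' + w') *
                  ker₁ (sclW (Lc ^ m) p) (sclFld (Lc ^ m) u') (sclBg (Lc ^ m) u' rad) b' (b' + w'))|
          ≤ 3 * (C * (((Lc ^ m : ℕ) : ℝ))⁻¹) * (D * (((Lc ^ m : ℕ) : ℝ))⁻¹) * (1 + 16 / δ ^ 2) *
            (C_G * (C_Γ * (3 + 8 * ((R₀ : ℝ) + 1) ^ 2)) *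
              ((((ℓ₀ : ℕ) : ℝ) * (((((Lc ^ m : ℕ) : ℝ)) ^ 4)⁻¹ * ∑ s, p s)) *
                (((1 + 80 * Real.exp (δ / 4) * (4 / δ) ^ 2) + (1 + 480 * Real.exp (δ / 4) * (4 / δ) ^ 4)) * (((Lc ^ m : ℕ) : ℝ)) ^ 2)) *
              ((((ℓ₀ : ℕ) : ℝ) * ∑ s, p s) * Real.exp (δ * R₀ / 2) *
                (Real.exp (δ / 2) * (1 + 480 * Real.exp (δ / 4) * (4 / δ) ^ 4)))) := by
  obtain ⟨δ₀, C, D, Cg, hδ₀, hC, hD, hCg, h⟩ := roadColumns_ghostLetters (Lc := Lc) hLc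
  refine ⟨δ₀, C, D, Cg, hδ₀, hC, hD, hCg, fun δ hδ hδle m hm κJ lJ σ _ p hp rad ℓ₀ R₀ hrad hradR U W G Γ C_G C_Γ hG hΓ S V v₀ => ?_⟩
  have hN1 : 1 ≤ Lc ^ m := Nat.one_le_pow m Lc (le_trans (by norm_num) hLc)
  obtain ⟨hJ, hJ', _, _⟩ := h δ hδ hδle m hm κJ lJ one_pos
  exact coarse_mix1_secondMoment_scl (N := Lc ^ m) hδ hN1 hp hrad hradR U W (J := fun b v => ((((Lc ^ m : ℕ) : ℝ) ^ 4) • colOf (KPerf (d := 3) Lc (sfStep Lc) (smStep 3 Lc) m)) κJ lJ (((Lc ^ m : ℕ) : ℤ) • v - b))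
    hG hΓ S V v₀ (fun b => hJ b v₀) (fun b' => hJ' b' V)

/-- **`ghost_mix3_rem_col` — THE (MIX-3) SCALAR WORD AT THE ROAD's COLUMNS** ([our object]): with `(δ₀, C, D, Cg)` of `roadColumns_ghostLetters`, for EVERY rate `δ ∈ (0, δ₀]`, `m ≥ 1`, `a > 0`, every
0-form rooted block family at blocking `N = Lc^m`, ANY coarse windows `U b`, all finite `W`, every fine profile `Γ` with (Γ₀)∕(Γ₁) and background-Laplacian jet `Ḣ` with (H)(H₀)
(rate `δ_H > 0` free), all finite `S`, `V`, every `v₀` (INNER leg `kerH (N−1) a` through its sup letter (I₀)):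
`Σ_{v∈V}‖v−v₀‖∞²·|Σ_{b,b′∈S} J_m(N•v₀−b)·J_m(N•v−b′)·Σ_{u∈U b}Σ_{w∈W} ker₁^{(u)} b (b+w)·Σ'_{x′} kerH(x′,u)·Σ'_x Γ(b+w,x)·Ḣ(b′,x,x′)|`
`≤ 3·(C·N⁻¹)·(D·N⁻¹)·(1+16∕δ²)·((Cg·(C_H·Zl 4 δ_H))·([Γ₁-part]·N + [Γ₀-part])·((ℓ₀·Σp)·e^{δR₀∕2}·(…)))` — powers of `N` displayed: `N⁻²·N¹·ℓ₀Σp·{C_H,C_Γ,C_Γ′}` × numbers. -/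
theorem ghost_mix3_rem_col (hLc : 2 ≤ Lc) :
    ∃ δ₀ C D Cg : ℝ, 0 < δ₀ ∧ 0 ≤ C ∧ 0 ≤ D ∧ 0 ≤ Cg ∧ ∀ δ : ℝ, 0 < δ → δ ≤ δ₀ → ∀ m : ℕ, 1 ≤ m → ∀ {a : ℝ}, 0 < a → ∀ (κJ lJ : Fin 4)
      {σ : Type*} [Fintype σ] {p : σ → ℝ} (_ : ∀ s, 0 ≤ p s)
        {rad : σ → Pt → Pt → List Pt} {ℓ₀ R₀ : ℕ} (_ : ∀ s u x', (rad s u x').length ≤ ℓ₀)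
        (_ : ∀ (s : σ) (u : Pt) (x : ↥(fineBlock (Lc ^ m))) (ℓ : Pt), ℓ ∈ rad s u x.1 → supNorm (ℓ - ((Lc ^ m : ℕ) : ℤ) • u) ≤ R₀ * Lc ^ m)
        (U : Pt → Finset Pt) (W : Finset Pt) {Γ : Pt → Pt → ℝ} {H : Pt → Pt → Pt → ℝ} {C_Γ C_Γ' C_H δH : ℝ} (_ : 0 < δH)
        (_ : ∀ c x, |Γ c x| ≤ C_Γ)
        (_ : ∀ c t (i : Fin 4), |Γ c (t + Pi.single i 1) - Γ c t|
          ≤ C_Γ' / ((supNorm (c - t) : ℝ) + 1) ^ 3 * Real.exp (-(δ / ((Lc ^ m : ℕ) : ℝ)) * (supNorm (c - t) : ℝ)))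
        (_ : ∀ b' x x', |H b' x x'| ≤ C_H * Real.exp (-δH * l1 (x - b')) * Real.exp (-δH * l1 (x' - b')))
        (_ : ∀ b' x', ∑' x, H b' x x' = 0)
        (S V : Finset Pt) (v₀ : Pt),
        ∑ v ∈ V, (supNorm (v - v₀) : ℝ) ^ 2 *
            |∑ b ∈ S, ∑ b' ∈ S, ((((Lc ^ m : ℕ) : ℝ) ^ 4) • colOf (KPerf (d := 3) Lc (sfStep Lc) (smStep 3 Lc) m)) κJ lJ (((Lc ^ m : ℕ) : ℤ) • v₀ - b) * ((((Lc ^ m : ℕ) : ℝ) ^ 4) • colOf (KPerf (d := 3) Lc (sfStep Lc) (smStep 3 Lc) m)) κJ lJ (((Lc ^ m : ℕ) : ℤ) • v - b') *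
              (∑ u ∈ U b, ∑ w ∈ W, ker₁ (sclW (Lc ^ m) p) (sclFld (Lc ^ m) u) (sclBg (Lc ^ m) u rad) b (b + w) *
                ∑' x', kerH (Lc ^ m - 1) a x' u * ∑' x, Γ (b + w) x * H b' x x')|
          ≤ 3 * (C * (((Lc ^ m : ℕ) : ℝ))⁻¹) * (D * (((Lc ^ m : ℕ) : ℝ))⁻¹) * (1 + 16 / δ ^ 2) *
            ((Cg * (C_H * Zl 4 δH)) *
              ((256 / 27 * C_Γ' * (Real.exp (δH / 2) * (2 / δH) * Zl 4 (δH / 2)))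
                  * ((1 + 2 * ((R₀ : ℝ) + 1) ^ 2) * (1 + 80 * Real.exp ((3 * δ / 4) / 2) * (2 / (3 * δ / 4)))
                    + 2 * (1 + 160 * Real.exp ((3 * δ / 4) / 2) * (2 / (3 * δ / 4)) ^ 3)) * ((Lc ^ m : ℕ) : ℝ)
                + (2 * C_Γ * 20 ^ 8 * (40320 * Real.exp (δH / 2) * (2 / δH) ^ 8 * Zl 4 (δH / 2))
                    + (8 * C_Γ * (Real.exp (δH / 2) * (2 / δH) * Zl 4 (δH / 2)) + 2 * C_Γ * (Real.exp (δH / 2) * Zl 4 (δH / 2))) * 5 ^ 8)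
                  * 81 * (3 + 2 * ((R₀ : ℝ) + 1) ^ 2)) *
              ((((ℓ₀ : ℕ) : ℝ) * ∑ s, p s) * Real.exp (δ * R₀ / 2) *
                (Real.exp (δ / 2) * (1 + 480 * Real.exp (δ / 4) * (4 / δ) ^ 4)))) := by
  obtain ⟨δ₀, C, D, Cg, hδ₀, hC, hD, hCg, h⟩ := roadColumns_ghostLetters (Lc := Lc) hLc
  refine ⟨δ₀, C, D, Cg, hδ₀, hC, hD, hCg, fun δ hδ hδle m hm a ha κJ lJ σ _ p hp rad ℓ₀ R₀ hrad hradR U W Γ H C_Γ C_Γ' C_H δH hδH hΓ0 hΓ1 hH hH0 S V v₀ => ?_⟩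
  have hN1 : 1 ≤ Lc ^ m := Nat.one_le_pow m Lc (le_trans (by norm_num) hLc)
  obtain ⟨hJ, hJ', _, hI0⟩ := h δ hδ hδle m hm κJ lJ ha
  exact coarse_mix3_secondMoment_scl (N := Lc ^ m) hδ hδH hN1 hp hrad hradR U W
    (I := fun c u => kerH (Lc ^ m - 1) a c u) (J := fun b v => ((((Lc ^ m : ℕ) : ℝ) ^ 4) • colOf (KPerf (d := 3) Lc (sfStep Lc) (smStep 3 Lc) m)) κJ lJ (((Lc ^ m : ℕ) : ℤ) • v - b))
    hI0 hΓ0 hΓ1 hH hH0 S V v₀ (fun b => hJ b v₀) (fun b' => hJ' b' V)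

end Ends

end Summit.QuantumFields.BalabanUV.Beta.FP.GhostPiecesAtColumns

end
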